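import Summits.Schanuel.Schanuel.Theorems.ZilberEacPuiseux
import Summits.Schanuel.Schanuel.Theorems.ZilberEacGraphUnramifiedBranch
import HarnessLib

/-!
# The equimodular class, LXXII: PUISEUX BRANCHES of an irreducible fibre curve — a parametrised
# zero branch at every root of `q₀`, and a cycle at infinity through every nonzero top-row root

HONEST FRAMING.  Cell `pub-schanuel` (Zilber's Exponential-Algebraic Closedness, case ladder;
host summit Schanuel), seat 2, gen 26.  The two local data required by the master theorem of file
LXVI, produced for EVERY irreducible `Q ∈ ℂ[s][t]` of positive `t`-degree by the Newton–Puiseux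
theorem of file LXXI:
* **`exists_zeroBranch_puiseux`** — at every root `a` of `q₀ = Q(s, 0)` (`q₀ ≠ 0`): `e ≥ 1` and `η`
  analytic at `0`, `η(0) = 0`, `η ≢ 0`, `Q(a + t^e, η(t)) = 0` near `0` (shift `s ↦ a + s`; the Bézout
  element of file LXVIII transported along the shift; `η ≢ 0` because `q₀ ≢ 0`);
* **`exists_fibreCycle_puiseux`** — at every nonzero root `θ` of the top row `T` (rows of degree
  `≤ N`, `T ≠ 0`): `k ≥ 1` and `ψ` analytic at `0`, `ψ(0) = θ`, `Q(s^{-k}, ψ(s)) = 0` for small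
  `s ≠ 0` (the reversed polynomial `Φ(u, y) = u^N Q(1/u, y)`, re-centred at `θ`; its Bézout element is
  the reversed one, `reflect`).
So over a polynomial graph NOTHING remains to be assumed about the shape of the fibre curve (file
LXXIII).  [folklore (Newton–Puiseux), made concrete]; nothing here is specific to Schanuel's
conjecture (neither used nor implied); Mantova–Masser's question (PLMS 2024 §1 p. 5) and EC(3,2) stay
OPEN.
-/

noncomputable section

open Filter Topology Polynomial

set_option linter.dupNamespace false

namespace Summit.Schanuel.Schanuel.Theorems

/-! ## Part A. Two-variable polynomials determined by their values off `s = 0` -/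

/-- Two-variable polynomials over `ℂ` with equal values at all `(x, y)` with `x ≠ 0` are equal.
[folklore] -/
theorem polyPoly_eq_of_eval_eq_of_ne_zero {Q₁ Q₂ : ℂ[X][X]}
    (h : ∀ x y : ℂ, x ≠ 0 →
      (Q₁.map (Polynomial.evalRingHom x)).eval y = (Q₂.map (Polynomial.evalRingHom x)).eval y) :
    Q₁ = Q₂ := by
  have hx : ∀ x : ℂ, x ≠ 0 → Q₁.map (Polynomial.evalRingHom x) = Q₂.map (Polynomial.evalRingHom x) :=
    fun x hx => Polynomial.funext fun y => h x y hx
  ext j : 1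
  refine Polynomial.eq_of_infinite_eval_eq _ _ ?_
  refine ((Set.finite_singleton (0 : ℂ)).infinite_compl).mono fun x hx0 => ?_
  simp only [Set.mem_compl_iff, Set.mem_singleton_iff] at hx0
  have := congrArg (fun q : ℂ[X] => q.coeff j) (hx x hx0)
  show (Q₁.coeff j).eval x = (Q₂.coeff j).eval x
  simpa only [Polynomial.coeff_map, Polynomial.coe_evalRingHom] using this

/-- **Row reversal.**  For `P ∈ ℂ[s][t]` with rows of degree `≤ M`, the polynomial
`rev_M P = Σ_j (reflect M p_j) t^j` satisfies `rev_M P (u, v) = u^M P(1/u, v)` for `u ≠ 0`.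
[folklore] -/
theorem eval_revPP (P : ℂ[X][X]) {M : ℕ} (hM : ∀ j, (P.coeff j).natDegree ≤ M) {u : ℂ} (hu : u ≠ 0)
    (v : ℂ) :
    ((∑ j ∈ Finset.range (P.natDegree + 1), Polynomial.monomial j (Polynomial.reflect M (P.coeff j))).map
        (Polynomial.evalRingHom u)).eval v =
      u ^ M * (P.map (Polynomial.evalRingHom u⁻¹)).eval v := by
  classical
  set Φ : ℂ[X][X] := ∑ j ∈ Finset.range (P.natDegree + 1), Polynomial.monomial j (Polynomial.reflect M (P.coeff j))
    with hΦ
  have hcoefΦ : ∀ j, Φ.coeff j = if j < P.natDegree + 1 then Polynomial.reflect M (P.coeff j) else 0 := by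
    intro j
    rw [hΦ, Polynomial.finsetSum_coeff]
    simp only [Polynomial.coeff_monomial, Finset.sum_ite_eq', Finset.mem_range]
  have hΦdeg : Φ.natDegree < P.natDegree + 1 := by
    refine Nat.lt_succ_of_le (Polynomial.natDegree_sum_le_of_forall_le _ _ fun j hj => ?_)
    exact (Polynomial.natDegree_monomial_le _).trans (Nat.lt_succ_iff.1 (Finset.mem_range.1 hj))
  rw [evalPP_eq_sum Φ u v hΦdeg, evalPP_eq_sum P _ v (Nat.lt_succ_self _), Finset.mul_sum]
  refine Finset.sum_congr rfl fun j hj => ?_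
  rw [hcoefΦ, if_pos (Finset.mem_range.1 hj)]
  haveI := invertibleOfNonzero (inv_ne_zero hu)
  have h := Polynomial.eval₂_reflect_mul_pow (RingHom.id ℂ) u⁻¹ M (P.coeff j) (hM j)
  rw [invOf_eq_inv, inv_inv] at h
  change (Polynomial.reflect M (P.coeff j)).eval u * u⁻¹ ^ M = (P.coeff j).eval u⁻¹ at h
  rw [← h, show u ^ M * ((Polynomial.reflect M (P.coeff j)).eval u * u⁻¹ ^ M * v ^ j) =
    (Polynomial.reflect M (P.coeff j)).eval u * v ^ j * (u * u⁻¹) ^ M by ring, mul_inv_cancel₀ hu, one_pow,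
    mul_one]

/-! ## Part B. A parametrised zero branch at every root of `q₀` -/

/-- **Puiseux at a zero.**  `Q ∈ ℂ[s][t]` irreducible of positive `t`-degree with `q₀ ≠ 0` and
`q₀(a) = 0`: there are `e ≥ 1` and `η` analytic at `0` with `η(0) = 0`, `η ≢ 0` and
`Q(a + t^e, η(t)) = 0` near `t = 0`. [folklore (Newton–Puiseux)] (new in this form) -/
theorem exists_zeroBranch_puiseux (Q : ℂ[X][X]) (hQirr : Irreducible Q) (hQ1 : Q.natDegree ≠ 0)
    (hQ00 : Q.coeff 0 ≠ 0) {a : ℂ} (ha : (Q.coeff 0).IsRoot a) :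
    ∃ (e : ℕ) (η : ℂ → ℂ), 1 ≤ e ∧ AnalyticAt ℂ η 0 ∧ η 0 = 0 ∧ (¬ ∀ᶠ t in 𝓝 (0 : ℂ), η t = 0) ∧
      ∀ᶠ t in 𝓝 (0 : ℂ), (Q.map (Polynomial.evalRingHom (a + t ^ e))).eval (η t) = 0 := by
  classical
  -- the shifted polynomial `F(s, t) = Q(a + s, t)`
  set φ : ℂ[X] →+* ℂ[X] := Polynomial.compRingHom (Polynomial.X + Polynomial.C a) with hφ
  set F : ℂ[X][X] := Q.map φ with hF
  have hφeval : ∀ s : ℂ, (Polynomial.evalRingHom s).comp φ = Polynomial.evalRingHom (a + s) := by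
    intro s
    refine RingHom.ext fun q => ?_
    rw [RingHom.comp_apply, hφ, Polynomial.coe_compRingHom_apply, Polynomial.coe_evalRingHom,
      Polynomial.coe_evalRingHom, Polynomial.eval_comp, Polynomial.eval_add, Polynomial.eval_C,
      Polynomial.eval_X, add_comm]
  have hFeval : ∀ s y : ℂ, (F.map (Polynomial.evalRingHom s)).eval y =
      (Q.map (Polynomial.evalRingHom (a + s))).eval y := by
    intro s y; rw [hF, Polynomial.map_map, hφeval]
  have hFcoef : ∀ j, (F.coeff j).eval 0 = (Q.coeff j).eval a := by
    intro j
    rw [hF, Polynomial.coeff_map, hφ, Polynomial.coe_compRingHom_apply, Polynomial.eval_comp]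
    simp
  -- the multiplicity `m` of `0` as a root of `Q(a, ·)`
  set Qa : ℂ[X] := Q.map (Polynomial.evalRingHom a) with hQa
  have hQa0 : Qa ≠ 0 := by
    obtain ⟨j, hj⟩ := exists_coeff_not_isRoot_of_irreducible hQirr hQ1 a
    intro h
    apply hj
    have := congrArg (Polynomial.coeff · j) h
    simp only [hQa, Polynomial.coeff_map, Polynomial.coe_evalRingHom, Polynomial.coeff_zero] at this
    exact this
  set m := Qa.natTrailingDegree with hm
  have hlow : ∀ j, j < m → (F.coeff j).IsRoot 0 := by
    intro j hj
    rw [Polynomial.IsRoot, hFcoef]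
    have := Polynomial.coeff_eq_zero_of_lt_natTrailingDegree (p := Qa) hj
    rwa [hQa, Polynomial.coeff_map, Polynomial.coe_evalRingHom] at this
  have htop : ¬ (F.coeff m).IsRoot 0 := by
    rw [Polynomial.IsRoot, hFcoef]
    have h := mt Polynomial.trailingCoeff_eq_zero.1 hQa0
    rw [Polynomial.trailingCoeff, hQa, Polynomial.coeff_map, Polynomial.coe_evalRingHom] at h
    exact h
  have hm1 : 1 ≤ m := by
    refine Polynomial.le_natTrailingDegree hQa0 fun i hi => ?_
    have hi0 : i = 0 := by omega
    subst hi0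
    rw [hQa, Polynomial.coeff_map, Polynomial.coe_evalRingHom]
    exact ha
  -- a Bézout element for `F`
  obtain ⟨A, B, r, hr, hAB⟩ := exists_bezout_derivative hQirr hQ1
  have hbezF : A.map φ * F + B.map φ * derivative F = Polynomial.C (φ r) := by
    rw [hF, Polynomial.derivative_map, ← Polynomial.map_mul, ← Polynomial.map_mul, ← Polynomial.map_add, hAB,
      Polynomial.map_C]
  have hφr : φ r ≠ 0 := by
    rw [hφ, Polynomial.coe_compRingHom_apply, Ne, Polynomial.comp_eq_zero_iff, not_or]
    refine ⟨hr, fun h => ?_⟩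
    have := congrArg (Polynomial.coeff · 1) h.2
    simp at this
  -- Newton–Puiseux
  obtain ⟨e, η, he, hηan, hη0, hroot⟩ :=
    exists_puiseux_zeroBranch_of_bezout m F hm1 hlow htop ⟨_, _, _, hφr, hbezF⟩
  refine ⟨e, η, he, hηan, hη0, ?_, ?_⟩
  · -- `η ≢ 0`, since `q₀ ≢ 0`
    intro hzero
    have hq : ∀ᶠ t in 𝓝 (0 : ℂ), (Q.coeff 0).eval (a + t ^ e) = 0 := by
      filter_upwards [hroot, hzero] with t ht hηt
      rw [hFeval, hηt, ← Polynomial.coeff_zero_eq_eval_zero, Polynomial.coeff_map,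
        Polynomial.coe_evalRingHom] at ht
      exact ht
    -- the entire function `t ↦ q₀(a + t^e)` vanishes identically
    have han : ∀ t : ℂ, AnalyticAt ℂ (fun t : ℂ => (Q.coeff 0).eval (a + t ^ e)) t := fun t =>
      analyticAt_polynomial_eval_comp (analyticAt_const.add (analyticAt_id.pow e)) _
    have hall := AnalyticOnNhd.eqOn_zero_of_preconnected_of_eventuallyEq_zero
      (fun t _ => han t) isPreconnected_univ (Set.mem_univ 0) hq
    apply hQ00
    refine Polynomial.funext fun s => ?_
    obtain ⟨t, ht⟩ := IsAlgClosed.exists_pow_nat_eq (s - a) (by omega : 0 < e)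
    have := hall (Set.mem_univ t)
    simp only [Pi.zero_apply] at this
    rw [ht, add_sub_cancel] at this
    rw [this, Polynomial.eval_zero]
  · filter_upwards [hroot] with t ht
    rwa [hFeval] at ht

/-! ## Part C. A cycle at infinity through every nonzero top-row root -/

/-- **Puiseux at infinity.**  `Q ∈ ℂ[s][t]` irreducible of positive `t`-degree with rows of degree
`≤ N`, top row `T ≠ 0`, and `θ ≠ 0`... in fact any root `θ` of `T`: there are `k ≥ 1` and `ψ`
analytic at `0` with `ψ(0) = θ` and `Q(s^{-k}, ψ(s)) = 0` for all small `s ≠ 0`.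
[folklore (Newton–Puiseux)] (new in this form) -/
theorem exists_fibreCycle_puiseux (Q : ℂ[X][X]) (hQirr : Irreducible Q) (hQ1 : Q.natDegree ≠ 0)
    (N : ℕ) (hN : ∀ j, (Q.coeff j).natDegree ≤ N) (T : ℂ[X]) (hT : ∀ j, T.coeff j = (Q.coeff j).coeff N)
    (hT0 : T ≠ 0) {θ : ℂ} (hTθ : T.IsRoot θ) :
    ∃ (k : ℕ) (ψ : ℂ → ℂ), 1 ≤ k ∧ AnalyticAt ℂ ψ 0 ∧ ψ 0 = θ ∧
      ∀ᶠ s in 𝓝[≠] (0 : ℂ), (Q.map (Polynomial.evalRingHom (s ^ k)⁻¹)).eval (ψ s) = 0 := by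
  classical
  -- the reversed polynomial `Φ(u, y) = u^N Q(1/u, y)` and its value at `u = 0`
  set Φ : ℂ[X][X] := ∑ j ∈ Finset.range (Q.natDegree + 1),
    Polynomial.monomial j (Polynomial.reflect N (Q.coeff j)) with hΦ
  have hΦeval : ∀ u : ℂ, u ≠ 0 → ∀ y : ℂ,
      (Φ.map (Polynomial.evalRingHom u)).eval y = u ^ N * (Q.map (Polynomial.evalRingHom u⁻¹)).eval y :=
    fun u hu y => eval_revPP Q hN hu y
  have hcoefΦ : ∀ j, Φ.coeff j = if j < Q.natDegree + 1 then Polynomial.reflect N (Q.coeff j) else 0 := by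
    intro j
    rw [hΦ, Polynomial.finsetSum_coeff]
    simp only [Polynomial.coeff_monomial, Finset.sum_ite_eq', Finset.mem_range]
  have hΦ0 : Φ.map (Polynomial.evalRingHom 0) = T := by
    ext j
    rw [Polynomial.coeff_map, hcoefΦ, Polynomial.coe_evalRingHom]
    split_ifs with hj
    · rw [← Polynomial.coeff_zero_eq_eval_zero, Polynomial.coeff_reflect, Polynomial.revAt_zero, hT]
    · rw [Polynomial.eval_zero, hT, Polynomial.coeff_eq_zero_of_natDegree_lt (p := Q) (by omega),
        Polynomial.coeff_zero]
  -- the re-centred polynomial `Ψ(u, v) = Φ(u, θ + v)` and the multiplicity of `θ`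
  obtain ⟨hlow, htop⟩ := recentre_facts hΦ0 hT0 θ
  set m := Polynomial.rootMultiplicity θ T with hm
  have hm1 : 1 ≤ m := (Polynomial.rootMultiplicity_pos hT0).2 hTθ
  -- a Bézout element for `Φ`: the reversed one
  obtain ⟨A, B, r, hr, hAB⟩ := exists_bezout_derivative hQirr hQ1
  set a : ℕ := max (max ((Finset.range (A.natDegree + 1)).sup fun j => (A.coeff j).natDegree)
    ((Finset.range (B.natDegree + 1)).sup fun j => (B.coeff j).natDegree)) r.natDegree with ha
  have haA : ∀ j, (A.coeff j).natDegree ≤ a := by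
    intro j
    by_cases hj : j < A.natDegree + 1
    · exact (Finset.le_sup (f := fun j => (A.coeff j).natDegree) (Finset.mem_range.2 hj)).trans
        ((le_max_left _ _).trans (le_max_left _ _))
    · rw [Polynomial.coeff_eq_zero_of_natDegree_lt (by omega), Polynomial.natDegree_zero]; exact Nat.zero_le _
  have haB : ∀ j, (B.coeff j).natDegree ≤ a := by
    intro j
    by_cases hj : j < B.natDegree + 1
    · exact (Finset.le_sup (f := fun j => (B.coeff j).natDegree) (Finset.mem_range.2 hj)).trans
        ((le_max_right _ _).trans (le_max_left _ _))
    · rw [Polynomial.coeff_eq_zero_of_natDegree_lt (by omega), Polynomial.natDegree_zero]; exact Nat.zero_le _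
  have har : r.natDegree ≤ a + N := (le_max_right _ _).trans (Nat.le_add_right _ _)
  set At : ℂ[X][X] := ∑ j ∈ Finset.range (A.natDegree + 1), Polynomial.monomial j (Polynomial.reflect a (A.coeff j))
    with hAt
  set Bt : ℂ[X][X] := ∑ j ∈ Finset.range (B.natDegree + 1), Polynomial.monomial j (Polynomial.reflect a (B.coeff j))
    with hBt
  set rt : ℂ[X] := Polynomial.reflect (a + N) r with hrt
  have hrt0 : rt ≠ 0 := by
    rw [hrt, Ne, Polynomial.reflect_eq_zero_iff]; exact hr
  -- `∂_v Φ (u, v) = u^N ∂_tQ(1/u, v)` for `u ≠ 0`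
  have hΦ'eval : ∀ u : ℂ, u ≠ 0 → ∀ y : ℂ, ((derivative Φ).map (Polynomial.evalRingHom u)).eval y =
      u ^ N * ((derivative Q).map (Polynomial.evalRingHom u⁻¹)).eval y := by
    intro u hu y
    have hP : Φ.map (Polynomial.evalRingHom u) = Polynomial.C (u ^ N) * Q.map (Polynomial.evalRingHom u⁻¹) := by
      refine Polynomial.funext fun y' => ?_
      rw [Polynomial.eval_mul, Polynomial.eval_C]; exact hΦeval u hu y'
    have h := congrArg (fun P : ℂ[X] => (derivative P).eval y) hP
    simp only [Polynomial.derivative_map, Polynomial.derivative_mul, Polynomial.derivative_C, zero_mul, zero_add,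
      Polynomial.eval_mul, Polynomial.eval_C] at h
    exact h
  have hbezΦ : At * Φ + Bt * derivative Φ = Polynomial.C rt := by
    refine polyPoly_eq_of_eval_eq_of_ne_zero fun u y hu => ?_
    rw [Polynomial.map_add, Polynomial.map_mul, Polynomial.map_mul, Polynomial.eval_add, Polynomial.eval_mul,
      Polynomial.eval_mul, eval_revPP A haA hu, eval_revPP B haB hu, hΦeval u hu, hΦ'eval u hu, evalPP_C]
    have hb := congrArg (fun P : ℂ[X][X] => (P.map (Polynomial.evalRingHom u⁻¹)).eval y) hAB
    simp only [Polynomial.map_add, Polynomial.map_mul, Polynomial.eval_add, Polynomial.eval_mul, evalPP_C] at hb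
    -- `rt(u) = u^{a+N} r(1/u)`
    haveI := invertibleOfNonzero (inv_ne_zero hu)
    have hrev := Polynomial.eval₂_reflect_mul_pow (RingHom.id ℂ) u⁻¹ (a + N) r har
    rw [invOf_eq_inv, inv_inv] at hrev
    change rt.eval u * u⁻¹ ^ (a + N) = r.eval u⁻¹ at hrev
    have hrt' : rt.eval u = u ^ (a + N) * r.eval u⁻¹ := by
      rw [← hrev, show u ^ (a + N) * (rt.eval u * u⁻¹ ^ (a + N)) = rt.eval u * (u * u⁻¹) ^ (a + N) by ring,
        mul_inv_cancel₀ hu, one_pow, mul_one]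
    rw [hrt', ← hb, pow_add]
    ring
  have hbezΨ := bezout_comp_X_add_C hbezΦ (Polynomial.C θ)
  -- Newton–Puiseux for `Ψ`
  obtain ⟨e, η, he, hηan, hη0, hroot⟩ :=
    exists_puiseux_zeroBranch_of_bezout m (Φ.comp (Polynomial.X + Polynomial.C (Polynomial.C θ))) hm1 hlow htop
      ⟨_, _, rt, hrt0, hbezΨ⟩
  refine ⟨e, fun s => η s + θ, he, hηan.add analyticAt_const, by simp [hη0], ?_⟩
  filter_upwards [self_mem_nhdsWithin, nhdsWithin_le_nhds hroot] with s (hs : s ≠ 0) hΨ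
  rw [evalPP_comp_X_add_C, Polynomial.eval_C, hΦeval _ (pow_ne_zero _ hs)] at hΨ
  exact (mul_eq_zero.1 hΨ).resolve_left (pow_ne_zero _ (pow_ne_zero _ hs))

end Summit.Schanuel.Schanuel.Theorems
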